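import Summits.BirchSwinnertonDyer.BirchSwinnertonDyer.Theorems.ClassRecordThreeEulerHalvesAtThreeWalkCompatData
import Summits.BirchSwinnertonDyer.BirchSwinnertonDyer.Theorems.KatoDescentTamePotSupersingularJetchevIrreducibleProp47Adapter2
import Summits.BirchSwinnertonDyer.BirchSwinnertonDyer.Theorems.Rank1ResidualJetRingClassFields
import Summits.BirchSwinnertonDyer.Rank1Residual.X11b.KolyvaginHpointsAssembly
import HarnessLib

/-!
# Cruxes `JetchevIrreducibleReadingByName` (20165) / `WildJetchevBoundAtP` (19941), registered stub S3′
# `stub_coreVertexExistenceIrredP` — step 4 of the irreducible port of bsd-jet's K5 strike: the walk's Prop. 4.7 input `h47` (a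
# BASED data family with equal localisation orders along increasing prime chains) on an IRREDUCIBLE row, from k8t-c4 g11's
# primed (B)-only `ℓ ≠ 2` reading `h47P2`

Cell `bsd-potss`, seat `bsd-potss-k9-c4` g10; `--supports stmt-BirchSwinnertonDyer-20165`, helper; route-free; one theorem;
CONDITIONAL on the displayed `h47P2` (fed by `h47P2_of_h44I` from the registered S5 text, or by `h47P2_of_prop37_2` from the
named fact `GrossLMS1991.prop37_2_frobeniusCongruence`); nothing booked, no item closed, BSD is not proved by any of this.
References: [cite: McCallumLMS1991, §4 Prop. 4.4] [cite: GrossLMS1991, §3, Prop. 3.7 (2)] [cite: Jetchev2008, Prop. 4.7, Rem. 6.2].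
presearch (D-0021): `lean search 'exists_data_h47Base'` → tam3-p1 (surjective, from the McCallum 4.4 fact), corner-p1
(`_of_frobeniusCongruence_of_irr`: from the Gross 3.7 (2) fact but with `p ≠ 3` — excluded for the K9 rows, `p = 3`; and
`_of_congruence_of_irr` / `_of_prop37_2_of_irr` on the corner frame); this file keys on the schema `h47P2` with the per-prime guard
`ℓ ≠ 2` instead, so `p = 3` is served. Kernel plumbing; corpus not needed.
-/

set_option autoImplicit false
-- the Theorems directory repeats the summit name (sibling precedent `KatoDescentPotSupersingularAssembly.lean`)
set_option linter.dupNamespace false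

noncomputable section

open scoped Classical NumberField Pointwise

open WeierstrassCurve IsDedekindDomain NumberField Literature.NumberTheory.EllipticCurves
  Literature.NumberTheory.EllipticCurves.ModularForms Literature.NumberTheory.EllipticCurves.Jetchev2008
  Literature.NumberTheory.GaloisRepresentations Literature.NumberTheory.GaloisRepresentations.DiscreteGaloisModule
  Summit.BirchSwinnertonDyer.Rank1Residual Summit.BirchSwinnertonDyer.Rank1Residual.X11b
  Summit.BirchSwinnertonDyer.Rank1Residual.X11b.Three Summit.BirchSwinnertonDyer.Rank1Residual.X11b.Three.Koly
  Summit.BirchSwinnertonDyer.Rank1Residual.JET Field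
  Summit.BirchSwinnertonDyer.BirchSwinnertonDyer.Theorems

namespace Summit.BirchSwinnertonDyer.BirchSwinnertonDyer.Theorems.JetchevIrreducibleCoreVertex

/-- **`h47` of the based ordered walk on an IRREDUCIBLE row, DISCHARGED modulo k8t-c4 g11's primed (B)-only `ℓ ≠ 2` reading
`h47P2` of [McC] Prop. 4.4 / [J] Prop. 4.7** (itself a theorem modulo Gross 1991 Prop. 3.7 (2), `JetchevIrreducibleProp44.h47P2_of_prop37_2`,
p541604). For `W` non-CM, `K` imaginary quadratic with `d_K ≠ −3, −4` and the Heegner hypothesis, `p` odd with `E[p]` irreducible and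
`p ∣ N_E`, a frame `(Dt, β, ι)`, a level `p^k` (`k ≥ 1`) and ANY datum `d` at an admissible conductor `n`: a data system `D` on the
admissible-conductor subtype with `D n = d` such that for every multiple `s` of `n`, every prime `ℓ ≠ 2`, `ℓ ∤ s`, above all prime
factors of `s` with `sℓ` admissible, and `λ ∋ ℓ`, the localisations at `λ` of `c_k(sℓ)` and `c_k(s)` have the same order — the
hypothesis `h47` of `exists_coreVertex_of_orderedFamilies_of_irreducible` VERBATIM (`c := n`). = tam3-p1's
`Koly.exists_data_h47Base_of_prop44` (the data = Gross's one system of choices by `Walk.exists_basedFamily_of_primeStep` from bsd-jet's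
compatible one-step extension `JET.exists_compatible_data_of_grossCM` — image-free) with the comparison step
`JetchevIrreducibleH63P2.addOrderOf_localization_kolyvaginClass_mul_eq_of_prop47IrredP2` in place of the surjective Prop. 4.4.
CONDITIONAL on `h47P2`. [cite: McCallumLMS1991, §4 Prop. 4.4 (p. 301)] [cite: GrossLMS1991, §3 (pp. 238–239), Prop. 3.7 (2), §4 (4.1)]
[cite: Jetchev2008, Prop. 4.4, Prop. 4.7 (p. 821), Rem. 6.2] -/
theorem exists_data_h47Base_of_prop47P2_of_irreducible
    (h47P2 : ∀ (W : WeierstrassCurve ℚ) [W.IsElliptic] [W.IsGloballyMinimal] [NeZero (W.conductorNorm ℤ)],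
        ¬ W.HasCM →
        ∀ (K : Type) [Field K] [NumberField K], IsImaginaryQuadratic K →
        NumberField.discr K ≠ -3 → NumberField.discr K ≠ -4 →
        SatisfiesHeegnerHypothesis (W.conductorNorm ℤ) K →
        ∀ (p : ℕ) [Fact p.Prime], p ≠ 2 → W.HasIrreducibleModPGaloisRep p → (p : ℤ) ∣ W.conductorNorm ℤ →
        ∀ (Dt : ModularParametrizationData W (W.conductorNorm ℤ)) (β : ℤ) (ι : K →+* ℂ)
          (M : ℕ), 1 ≤ M →
        ∀ (m l : ℕ), Squarefree (m * l) → l.Prime → l ≠ 2 → ¬ l ∣ m →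
          (∀ l' ∈ (m * l).primeFactors, Zhang2014.IsKolyvaginPrime (W.conductorNorm ℤ) W K p l' ∧
            M ≤ Zhang2014.kolyvaginIndex W p l') →
        ∀ (d : KolyvaginHeegnerData Dt β ι m) (d' : KolyvaginHeegnerData Dt β ι (m * l)),
          (∀ l' ∈ m.primeFactors, ∀ (x : ringClassField K ι m) (x' : ringClassField K ι (m * l)),
            (x : ℂ) = x' → ((d'.σ l' x' : ringClassField K ι (m * l)) : ℂ) = (d.σ l' x : ℂ)) →
          (∀ s ∈ d.S, ∃ s' ∈ d'.S, ∀ (x : ringClassField K ι m) (x' : ringClassField K ι (m * l)),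
            (x : ℂ) = x' → ((s' x' : ringClassField K ι (m * l)) : ℂ) = (s x : ℂ)) →
          (∀ s' ∈ d'.S, ∃ s ∈ d.S, ∀ (x : ringClassField K ι m) (x' : ringClassField K ι (m * l)),
            (x : ℂ) = x' → ((s' x' : ringClassField K ι (m * l)) : ℂ) = (s x : ℂ)) →
          (∀ (x : ringClassField K ι m) (x' : ringClassField K ι (m * l)),
            (x : ℂ) = x' → d'.emb x' = d.emb x) →
        ∀ (v : HeightOneSpectrum (𝓞 K)), (l : 𝓞 K) ∈ v.asIdeal →
        ∀ (j : ℕ),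
          (((p ^ j : ℕ) : ℤ) • d'.kolyvaginClass (Fact.out : p.Prime) M ∈
              (W.baseChange K).torsionLocalKer (v.adicCompletion K) ((p ^ M : ℕ) : ℤ) ↔
            ((p ^ j : ℕ) : ℤ) • d.kolyvaginClass (Fact.out : p.Prime) M ∈
              (W.baseChange K).torsionLocalKer (v.adicCompletion K) ((p ^ M : ℕ) : ℤ)))
    (W : WeierstrassCurve ℚ) [W.IsElliptic] [W.IsGloballyMinimal] [NeZero (W.conductorNorm ℤ)]
    (hcm : ¬ W.HasCM) {K : Type} [Field K] [NumberField K] (hK : IsImaginaryQuadratic K)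
    (hD3 : NumberField.discr K ≠ -3) (hD4 : NumberField.discr K ≠ -4)
    (hH : SatisfiesHeegnerHypothesis (W.conductorNorm ℤ) K)
    {p : ℕ} [Fact p.Prime] (hp2 : p ≠ 2) (hirr : W.HasIrreducibleModPGaloisRep p) (hpN : p ∣ W.conductorNorm ℤ)
    (Dt : ModularParametrizationData W (W.conductorNorm ℤ)) (β : ℤ) (ι : K →+* ℂ) {k : ℕ} (hk : 1 ≤ k)
    {n : ℕ} (hn : Squarefree n ∧ ∀ q ∈ n.primeFactors,
      Zhang2014.IsKolyvaginPrime (W.conductorNorm ℤ) W K p q ∧ k ≤ Zhang2014.kolyvaginIndex W p q)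
    (d : KolyvaginHeegnerData Dt β ι n) :
    ∃ D : ∀ s : {m : ℕ // Squarefree m ∧ ∀ q ∈ m.primeFactors,
        Zhang2014.IsKolyvaginPrime (W.conductorNorm ℤ) W K p q ∧ k ≤ Zhang2014.kolyvaginIndex W p q},
        KolyvaginHeegnerData Dt β ι s.1, D ⟨n, hn⟩ = d ∧
      ∀ (s s' : {m : ℕ // Squarefree m ∧ ∀ q ∈ m.primeFactors,
        Zhang2014.IsKolyvaginPrime (W.conductorNorm ℤ) W K p q ∧ k ≤ Zhang2014.kolyvaginIndex W p q})
        (ℓ : ℕ), ℓ.Prime → ℓ ≠ 2 → ¬ ℓ ∣ s.1 → s'.1 = s.1 * ℓ → (∀ q ∈ s.1.primeFactors, q < ℓ) → n ∣ s.1 →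
      ∀ v : HeightOneSpectrum (𝓞 K), (ℓ : 𝓞 K) ∈ v.asIdeal →
      addOrderOf (galoisCohomology.localization ((W.baseChange K).torsionGaloisModule ((p ^ k : ℕ) : ℤ))
          (Sum.inr v) 1 ((D s').kolyvaginClass (Fact.out : p.Prime) k)) =
        addOrderOf (galoisCohomology.localization ((W.baseChange K).torsionGaloisModule ((p ^ k : ℕ) : ℤ))
          (Sum.inr v) 1 ((D s).kolyvaginClass (Fact.out : p.Prime) k)) := by
  haveI : ∀ j : ℕ, NumberField (ringClassField K ι j) := numberField_ringClassField K hK ι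
  have hD : NumberField.discr K < -4 := KolyvaginAssembly.discr_lt_neg_four hK ⟨hD3, hD4⟩
  -- the based family of compatible data
  obtain ⟨D, hDn, hR⟩ := Walk.exists_basedFamily_of_primeStep
    (data := fun m ↦ KolyvaginHeegnerData Dt β ι m)
    (fun m ↦ Squarefree m ∧ ∀ q ∈ m.primeFactors,
      Zhang2014.IsKolyvaginPrime (W.conductorNorm ℤ) W K p q ∧ k ≤ Zhang2014.kolyvaginIndex W p q)
    (R := fun {a b} (dc : KolyvaginHeegnerData Dt β ι a) (d' : KolyvaginHeegnerData Dt β ι b) ↦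
      (∀ l' ∈ a.primeFactors, ∀ (x : ringClassField K ι a) (x' : ringClassField K ι b),
        (x : ℂ) = x' → ((d'.σ l' x' : ringClassField K ι b) : ℂ) = (dc.σ l' x : ℂ)) ∧
      (∀ t ∈ dc.S, ∃ t' ∈ d'.S, ∀ (x : ringClassField K ι a) (x' : ringClassField K ι b),
        (x : ℂ) = x' → ((t' x' : ringClassField K ι b) : ℂ) = (t x : ℂ)) ∧
      (∀ t' ∈ d'.S, ∃ t ∈ dc.S, ∀ (x : ringClassField K ι a) (x' : ringClassField K ι b),
        (x : ℂ) = x' → ((t' x' : ringClassField K ι b) : ℂ) = (t x : ℂ)) ∧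
      (∀ (x : ringClassField K ι a) (x' : ringClassField K ι b),
        (x : ℂ) = x' → d'.emb x' = dc.emb x))
    (fun m h ↦ h.1) (fun m m' h hm' ↦ ⟨h.1.squarefree_of_dvd hm', fun q hq ↦
      h.2 q (Nat.primeFactors_mono hm' h.1.ne_zero hq)⟩)
    (fun m h ↦ BirchSwinnertonDyer.Theorems.nonempty_kolyvaginHeegnerData_of_grossCM
      (phi_heegnerPointOfConductor_mem_range_map_ringClassField_holds _ W K)
      exists_generator_ringClassGalOver_holds hK hH Dt β ι d.dvd_sq_sub h.1
      (fun q hq ↦ (h.2 q hq).1.2.2.2.2.1))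
    (fun c ℓ dc hA hℓ ↦ by
      have hc0 : c * ℓ ≠ 0 := hA.1.ne_zero
      obtain ⟨hcop, hc, -⟩ := Nat.squarefree_mul_iff.mp hA.1
      have hcK : ∀ q ∈ c.primeFactors, Zhang2014.IsKolyvaginPrime (W.conductorNorm ℤ) W K p q :=
        fun q hq ↦ (hA.2 q (Nat.primeFactors_mono (dvd_mul_right c ℓ) hc0 hq)).1
      have hKol : Zhang2014.IsKolyvaginPrime (W.conductorNorm ℤ) W K p ℓ :=
        (hA.2 ℓ (Nat.mem_primeFactors.mpr ⟨hℓ, dvd_mul_left ℓ c, hc0⟩)).1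
      have hℓc : ℓ ∉ c.primeFactors := fun h ↦
        (Nat.Prime.coprime_iff_not_dvd hℓ).mp hcop.symm (Nat.dvd_of_mem_primeFactors h)
      obtain ⟨dℓ, hdℓ⟩ := exists_compatible_data_of_grossCM
        (phi_heegnerPointOfConductor_mem_range_map_ringClassField_holds _ W K) hK hD hH p Dt β ι hc
        hcK dc
      exact ⟨dℓ ℓ hKol hℓc, hdℓ ℓ hKol hℓc⟩)
    hn d
  refine ⟨D, hDn, ?_⟩
  intro s s' ℓ hℓ hℓ2 hℓs hs' hlt hns v hv
  obtain ⟨hσ, hS1, hS2, hemb⟩ := hR s s' ℓ hℓ hℓs hs' hlt hns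
  -- transport the datum at `s'` along `s'.1 = s.1 * ℓ`
  obtain ⟨m', hm'⟩ := s'
  change m' = s.1 * ℓ at hs'
  subst hs'
  exact JetchevIrreducibleH63P2.addOrderOf_localization_kolyvaginClass_mul_eq_of_prop47IrredP2 h47P2 W hcm K hK
    hD3 hD4 hH p hp2 hirr hpN Dt β ι k hk s.1 ℓ hm'.1 hℓ hℓ2 hℓs hm'.2 (D s) (D ⟨s.1 * ℓ, hm'⟩) hσ hS1 hS2 hemb v hv


end Summit.BirchSwinnertonDyer.BirchSwinnertonDyer.Theorems.JetchevIrreducibleCoreVertex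

end
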